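import Summits.CriticalPhenomena.CardyFormulaZ2.Theorems.CardyIKTransportIKLinearTransportPinnedDefs
import Summits.CriticalPhenomena.CardyFormulaZ2.Theorems.CardyIKTransportIKLinearTransportStubDiagramExchange
import Summits.CriticalPhenomena.CardyFormulaZ2.Theorems.CardyIKTransportIKLinearTransportStubExchangeAssembly
import Summits.CriticalPhenomena.CardyFormulaZ2.Theorems.CardyIKTransportIKLinearTransportStubStripDiagramExchange
import Summits.CriticalPhenomena.CardyFormulaZ2.Theorems.CardyIKTransportIKLinearTransportStubPinnedSamplerRowCFTPFinal
import Summits.CriticalPhenomena.CardyFormulaZ2.Theorems.CardyIKTransportIKLinearTransportStubCoalescingRowKernelReduction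
import Summits.CriticalPhenomena.CardyFormulaZ2.Theorems.CardyIKTransportIKLinearTransportStubRowCFTPRemains
import Summits.CriticalPhenomena.CardyFormulaZ2.Theorems.CardyIKTransportIKLinearTransportStubCutMarkovKernel
import Summits.CriticalPhenomena.CardyFormulaZ2.Theorems.CardyIKTransportIKLinearTransportStubCutMarkovLocalTransfer
import Summits.CriticalPhenomena.CardyFormulaZ2.Theorems.CardyIKTransportIKLinearTransportTwoSidedKernelFinal

/-!
# THE BET of the line `pinned-diagram-exchange` PROVED: Manolescu's exchange maps for the Izergin–Korepin family
# (crux stmt-CriticalPhenomena-5076 `CardyIKTransport.IKLinearTransport`)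

Theorem-only file (`--supports stmt-CriticalPhenomena-5076`, lead c2; registered sub-goal `exchangeKernels_IK`). The chain of
LANDED stubs of the line, composed exactly as in the lead's skeleton v12: (K) `stub_CutMarkovKernel` (p126568) and (K₂)
`stub_TwoSidedCutMarkovKernel` (p129077) ⇒ (Loc) `cutMarkovLocal_holds` (transfer p125069) ⇒ (A_dyn') `coalescingRowKernel_holds`
(p122881) ⇒ (A_dyn) `rowCFTP_holds` (p119461) ⇒ `pinnedSampler_holds` (coding step p112711) ⇒ with `stub_StripDiagramExchange` (p97886)
and `stub_ExchangeAssembly` (p93768) the v2 signature of `stub_PinnedExchange` (`pinnedExchange_of_parts`, p93016), and with the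
finite pinned Yang–Baxter identity `stub_DiagramExchange` (p91210) THE UNCONDITIONAL STATEMENT `exchangeKernels_IK`:

  for every column pattern `S` and adjacent face columns `i, i+1` of different type there is an EXCHANGE MAP
  `T : Obs → Rnd → Obs` (`IsExchangeKernel C c S i T`: it transports `ν_S ⊗ β` to `ν_{S ∆ {i,i+1}}`, keeps a.s. the colours
  off the middle cell column and the monochromatic connectivities between off-column cells, is vertically covariant, and
  is quasi-local with exponential tails, constants uniform in `S, i`)

— Fact 5.15 of I. Manolescu, arXiv:2502.08394 (there for FK percolation via the star–triangle transformation and FKG) for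
the `n = 1` dilute `A₂⁽²⁾` / Izergin–Korepin family at `λ = π/3`, WITHOUT FKG: by diagram-pinned resampling of the middle
column (the pinned Yang–Baxter identity on cylinders, strip diagram exchange, and coupling-from-the-past of the
diagram-conditioned middle column through its cut rows).
-/

noncomputable section

namespace Summit.CriticalPhenomena.CardyFormulaZ2.Theorems.IKLinearTransport.PinnedDiagramExchange

open scoped BigOperators Topology Classical MeasureTheory ProbabilityTheory ENNReal symmDiff
open Filter Set Function MeasureTheory
open Literature.Probability.Percolation Literature.Probability.LatticeModels

/-- `stub_CutMarkovLocal` ((Loc), v10), DERIVED from the LANDED (K₂) `stub_TwoSidedCutMarkovKernel` by the landed transfer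
(p125069). [folklore] -/
theorem cutMarkovLocal_holds :
    ∃ C c : ℝ, 0 < c ∧ ∀ (S : Set ℤ) (i : ℤ) (k : (Obs × Set (Site 2 × Site 2)) × Obs → Bool × Bool × Bool → ℝ),
      (i ∈ S ↔ i + 1 ∉ S) → StripDiagramExchange S i → CutMarkovKernel S i k →
      ∀ (v : Site 2) (r : ℕ), ∃ Gfin : Obs → Rnd → Obs,
        (∀ (x x' : Obs) (u u' : Rnd),
          (∀ w ∈ ballInf v (2 * r), (w ∈ x.1 ↔ w ∈ x'.1) ∧ (w ∈ x.2 ↔ w ∈ x'.2) ∧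
            ∀ k : ℕ, ((w, k) ∈ u ↔ (w, k) ∈ u')) →
          ∀ w ∈ ballInf v r, (w ∈ (Gfin x u).1 ↔ w ∈ (Gfin x' u').1) ∧ (w ∈ (Gfin x u).2 ↔ w ∈ (Gfin x' u').2)) ∧
        ((νmix S).prod β) {xu | ∃ w ∈ ballInf v r,
          (w 0 = i + 1 ∧ ¬ (w ∈ (rowSweep (rowDyn i crkU (crkG S i k)) (r + 1) (w 1 - r) (pinnedStat i xu.1) xu.2
              (eraseMid i xu.1)).1 ↔ w ∈ (Gfin xu.1 xu.2).1)) ∨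
          ((w 0 = i ∨ w 0 = i + 1) ∧ ¬ (w ∈ (rowSweep (rowDyn i crkU (crkG S i k)) (r + 1) (w 1 - r) (pinnedStat i xu.1)
              xu.2 (eraseMid i xu.1)).2 ↔ w ∈ (Gfin xu.1 xu.2).2))} ≤ ENNReal.ofReal (C * Real.exp (-c * r)) :=
  cutMarkov_local_approx_of_twoSided stub_TwoSidedCutMarkovKernel

/-- `stub_CoalescingRowKernel` (A_dyn', v9), DERIVED from the LANDED (K) `stub_CutMarkovKernel` (p126568) and the
derived (Loc) by the landed cut-Markov reduction (p122881). [folklore] -/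
theorem coalescingRowKernel_holds :
    ∃ C c : ℝ, 0 < c ∧ ∀ (S : Set ℤ) (i : ℤ), (i ∈ S ↔ i + 1 ∉ S) → StripDiagramExchange S i →
      ∃ (U : Site 2 → Rnd → ℝ) (G : ((Obs × Set (Site 2 × Site 2)) × Obs) × ℝ → Obs)
        (Coal : ℤ → ℕ → Set ((Obs × Set (Site 2 × Site 2)) × Rnd)),
        (∀ v, Measurable (U v)) ∧
        (∀ v (u u' : Rnd), (∀ k : ℕ, ((v, k) ∈ u ↔ (v, k) ∈ u')) → U v u = U v u') ∧
        (∀ v (m : ℤ) (u : Rnd), U v (ushift m u) = U (v - ![0, m]) u) ∧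
        Measurable G ∧
        ((νmix (S ∆ {i, i + 1})).prod β).map
            (fun xu => (rowStat i xu.1, G (rowStat i xu.1, U ![i + 1, 0] xu.2))) =
          (νmix (S ∆ {i, i + 1})).map (fun x => (rowStat i x, x)) ∧
        (∀ y m, MeasurableSet (Coal y m)) ∧
        (∀ (y : ℤ) (m : ℕ) (p : Obs × Set (Site 2 × Site 2)) (u : Rnd), (p, u) ∈ Coal y m → ∀ z : Obs,
          (![i + 1, y] ∈ (rowSweep (rowDyn i U G) (m + 1) (y - m) p u z).1 ↔
            ![i + 1, y] ∈ (rowSweep (rowDyn i U G) (m + 1) (y - m) p u p.1).1) ∧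
          (![i, y] ∈ (rowSweep (rowDyn i U G) (m + 1) (y - m) p u z).2 ↔
            ![i, y] ∈ (rowSweep (rowDyn i U G) (m + 1) (y - m) p u p.1).2) ∧
          (![i + 1, y] ∈ (rowSweep (rowDyn i U G) (m + 1) (y - m) p u z).2 ↔
            ![i + 1, y] ∈ (rowSweep (rowDyn i U G) (m + 1) (y - m) p u p.1).2)) ∧
        (∀ (y : ℤ) (m : ℕ), ((νmix S).prod β) {xu | (pinnedStat i xu.1, xu.2) ∉ Coal y m} ≤
          ENNReal.ofReal (C * Real.exp (-c * m))) ∧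
        (∀ (y : ℤ) (m : ℕ) (k : ℤ) (x : Obs) (u : Rnd),
          (pinnedStat i (vshift k x), ushift k u) ∈ Coal y m ↔ (pinnedStat i x, u) ∈ Coal (y - k) m) ∧
        (∀ (v : Site 2) (r : ℕ), ∃ Gfin : Obs → Rnd → Obs,
          (∀ (x x' : Obs) (u u' : Rnd),
            (∀ w ∈ ballInf v (2 * r), (w ∈ x.1 ↔ w ∈ x'.1) ∧ (w ∈ x.2 ↔ w ∈ x'.2) ∧
              ∀ k : ℕ, ((w, k) ∈ u ↔ (w, k) ∈ u')) →
            ∀ w ∈ ballInf v r, (w ∈ (Gfin x u).1 ↔ w ∈ (Gfin x' u').1) ∧ (w ∈ (Gfin x u).2 ↔ w ∈ (Gfin x' u').2)) ∧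
          ((νmix S).prod β) {xu | ∃ w ∈ ballInf v r,
            (w 0 = i + 1 ∧ ¬ (w ∈ (rowSweep (rowDyn i U G) (r + 1) (w 1 - r) (pinnedStat i xu.1) xu.2
                (eraseMid i xu.1)).1 ↔ w ∈ (Gfin xu.1 xu.2).1)) ∨
            ((w 0 = i ∨ w 0 = i + 1) ∧ ¬ (w ∈ (rowSweep (rowDyn i U G) (r + 1) (w 1 - r) (pinnedStat i xu.1) xu.2
                (eraseMid i xu.1)).2 ↔ w ∈ (Gfin xu.1 xu.2).2))} ≤ ENNReal.ofReal (C * Real.exp (-c * r))) :=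
  coalescingRowKernel_of_cutMarkov stub_CutMarkovKernel cutMarkovLocal_holds

/-- `stub_RowCFTP` (A_dyn, v7), DERIVED from (A_dyn') by the landed reduction (p119461). [folklore] -/
theorem rowCFTP_holds :
    ∃ C c : ℝ, 0 < c ∧ ∀ (S : Set ℤ) (i : ℤ), (i ∈ S ↔ i + 1 ∉ S) → StripDiagramExchange S i →
      ∃ (Φ : ℤ → Obs × Set (Site 2 × Site 2) → Rnd → Obs → Obs)
        (Coal : ℤ → ℕ → Set ((Obs × Set (Site 2 × Site 2)) × Rnd)), IsRowCFTP C c S i Φ Coal :=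
  rowCFTP_of_coalescingRowKernel coalescingRowKernel_holds

/-- `stub_PinnedSampler` (v5), DERIVED from (A_dyn) by the landed coding step (p112711). [folklore] -/
theorem pinnedSampler_holds :
    ∃ C c : ℝ, 0 < c ∧ ∀ (S : Set ℤ) (i : ℤ), (i ∈ S ↔ i + 1 ∉ S) →
      ∃ G : Obs → Rnd → Obs, PinnedSampler C c S i G :=
  pinnedSampler_of_uniformRowCFTP rowCFTP_holds

/-- `stub_PinnedExchange` (v2), DERIVED (landed `stub_StripDiagramExchange` p97886, `pinnedSampler`,
landed `stub_ExchangeAssembly` p93768, composition `pinnedExchange_of_parts` p93016). [folklore] -/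
theorem pinnedExchange_holds :
    (∀ (L : ℕ) [NeZero L], 3 ≤ L → DiagramExchangeAt L) →
      ∃ C c : ℝ, 0 < c ∧ ∀ (S : Set ℤ) (i : ℤ), (i ∈ S ↔ i + 1 ∉ S) →
        ∃ T : Obs → Rnd → Obs, IsExchangeKernel C c S i T :=
  pinnedExchange_of_parts stub_StripDiagramExchange pinnedSampler_holds stub_ExchangeAssembly

/-- THE EXCHANGE MAPS OF THE IZERGIN–KOREPIN FAMILY EXIST (registered sub-goal `exchangeKernels_IK`; Manolescu's Fact 5.15
for IK, unconditional: the finite pinned Yang–Baxter identity `stub_DiagramExchange` feeds `pinnedExchange`). [folklore] -/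
theorem exchangeKernels_IK : ∃ C c : ℝ, 0 < c ∧ ∀ (S : Set ℤ) (i : ℤ), (i ∈ S ↔ i + 1 ∉ S) → ∃ T : Obs → Rnd → Obs, IsExchangeKernel C c S i T :=
  pinnedExchange_holds stub_DiagramExchange

end Summit.CriticalPhenomena.CardyFormulaZ2.Theorems.IKLinearTransport.PinnedDiagramExchange
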